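import Summits.QuantumFields.YangMills.Theorems.BalabanLadderUVSeamRecCeilingsRarityTools
import HarnessLib

/-!
# Crux `UVSeamRec` (stmt-QuantumFields-20043), stub `stub_ceilings` (E0′): multiplicative rarity WITHOUT reflection
# positivity — Chebyshev on joint exponential moments, and the POLYMER-GAS domination that supplies them

Helper file (`--supports stmt-QuantumFields-20043`) of the width-lever seat `ym-20043-ceilings-p2` (lane B of the stub
`stub_ceilings : UV → MomentBounds6 SU(2) rF uRec`, slot v4-F).  HONEST FRAMING: pure measure theory / combinatorics for
the CONSUMPTION side of an OPEN hypothesis (a Peierls-type product law for the large-field «polymer gas» of the Wilson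
state on odd tori, of the kind Bałaban's renormalisation operation produces); nothing about Yang–Mills at weak coupling
is asserted here; not E0′, not a gap, not Clay.

WHY.  The landed defect collar (`DefectCollar.abs_integral_prod_sub_mean_le_of_defects`, p518354; route corollaries
`momentBounds6_of_goodLaw_and_rarity` / `momentBounds6OnSides_of_goodLaw_and_rarity`, p519295) turns (a) a kernel law on
GOOD exteriors plus (b) MULTIPLICATIVE RARITY `μ_T(⋂_{i∈T} Badᵢ) ≤ δ^{#T}` of the bad cube-exteriors under the torus state
into the ceilings.  Lane A (seam-s2) supplies (b) by a block chessboard estimate, which needs reflection positivity AND a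
tiling of the torus side by equal blocks of the collar width — impossible at prime sides, so it serves only a CLASS of
sides (`MomentBounds6OnSides … familySides`), not the registered all-odd-sides currency `MomentBounds6` (seat note
`CEILINGS-KERNEL-ANALYSIS-seam-s2.md` rev 2 §5).  This file gives the supplier of (b) that uses NEITHER reflection
positivity NOR divisibility, on a probability space of any kind:

* §1 CHEBYSHEV — `measureReal_biInter_le_pow_of_expMoment`: if the bad events are super-level sets `{θ ≤ Iᵢ}` of
  measurable «influence functionals» `Iᵢ` and the JOINT exponential moment is multiplicatively bounded,
  `∫ exp(λ Σ_{i∈T} Iᵢ) dμ ≤ exp(B·#T)` (`λ ≥ 0`), then `μ(⋂_{i∈T} {θ ≤ Iᵢ}) ≤ exp(B − λθ)^{#T}`.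
* §2 POLYMER-GAS DOMINATION — `integral_exp_sum_indicator_le_prod`: for a finite family of events `E_γ` («the
  large-field polymer `γ` occurs») obeying the Peierls PRODUCT LAW `μ(⋂_{γ∈A} E_γ) ≤ ∏_{γ∈A} w_γ` for every sub-family
  `A` (weights `w_γ ≥ 0`; for Bałaban-type large-field regions `w_γ ≈ e^{−c β |γ|}`), and tilts `t_γ ≥ 0`,
  `∫ exp(Σ_γ t_γ 1_{E_γ}) dμ ≤ ∏_γ (1 + (e^{t_γ} − 1) w_γ) ≤ exp(Σ_γ (e^{t_γ} − 1) w_γ)` — the exponential moments of the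
  interacting polymer gas are dominated by those of the IDEAL gas of intensities `w_γ` (expand `∏ (1 + c_γ 1_{E_γ})`
  over sub-families, integrate termwise with the product law, resum).  Hence, for LINEAR influence functionals
  `Iᵢ = Σ_γ a_{iγ} 1_{E_γ}` (`a ≥ 0`) with `Σ_{i∈T} a_{iγ} ≤ Λ` (total influence of one polymer) and `Σ_γ a_{iγ} w_γ ≤ W`
  (mean influence on one cube — the «density `e^{−cβ}`» number): `∫ exp(λ Σ_{i∈T} Iᵢ) dμ ≤ exp(λ e^{λΛ} W · #T)`
  (`integral_exp_mul_sum_influence_le`), and with §1 **`measureReal_biInter_le_pow_of_polymerLaw`**: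
  `μ(⋂_{i∈T} {θ ≤ Iᵢ}) ≤ exp(λ e^{λΛ} W − λ θ)^{#T}` — hypothesis (b) of the defect collar, any measure, any index set.
* sibling file `…CeilingsPolymerRarityMoments.lean`: the route-vocabulary corollary on ALL odd tori
  (`MomentBounds6 G r a` from a tempered centre law for `Good := {I < θ}` plus the polymer law of the Wilson state).

References: folklore (exponential Chebyshev inequality); the ideal-gas domination is the zeroth order of the polymer /
cluster expansion — R. Kotecký, D. Preiss, Commun. Math. Phys. 103 (1986) 491–498; D. Brydges, *A short course on cluster
expansions*, Les Houches 1984, §2; the intended product-law input is of the kind of T. Bałaban, Commun. Math. Phys. 122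
(1989) 355–392, (1.79)–(1.89) (large-field regions are suppressed exponentially in their size).
-/

set_option autoImplicit false

noncomputable section

open MeasureTheory Finset
open Literature.MathematicalPhysics.QuantumLattice (integrable_of_abs_le)
open Summit.QuantumFields.YangMills.Cruxes.UVSeamRec.DefectCollar (integral_prod_indicator_eq_measureReal
  prod_indicator_one_eq_indicator_biInter)

namespace Summit.QuantumFields.YangMills.Cruxes.UVSeamRec.PolymerRarity

variable {Ω : Type*} [MeasurableSpace Ω] (μ : Measure Ω) [IsProbabilityMeasure μ]

/-! ## §1 Chebyshev: multiplicative rarity of super-level sets from a joint exponential moment bound -/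

section Chebyshev

omit [MeasurableSpace Ω] in
/-- Pointwise exponential Chebyshev bound for one super-level indicator: `1[θ ≤ I] ≤ exp(λ (I − θ))` for `λ ≥ 0`.
[folklore] -/
theorem indicator_le_exp_mul_sub (I : Ω → ℝ) (θ : ℝ) {lam : ℝ} (hlam : 0 ≤ lam) (ω : Ω) :
    {ω | θ ≤ I ω}.indicator (fun _ => (1 : ℝ)) ω ≤ Real.exp (lam * (I ω - θ)) := by
  by_cases h : ω ∈ {ω | θ ≤ I ω}
  · rw [Set.indicator_of_mem h]
    have hθ : θ ≤ I ω := h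
    exact Real.one_le_exp (mul_nonneg hlam (sub_nonneg.2 hθ))
  · rw [Set.indicator_of_notMem h]
    positivity

omit [MeasurableSpace Ω] in
/-- Pointwise exponential Chebyshev bound for a product of super-level indicators:
`∏_{i∈T} 1[θᵢ ≤ Iᵢ] ≤ exp(−λ Σ_{i∈T} θᵢ) · exp(λ Σ_{i∈T} Iᵢ)` for `λ ≥ 0`. [folklore] -/
theorem prod_indicator_le_exp {ι : Type*} (T : Finset ι) (I : ι → Ω → ℝ) (θ : ι → ℝ) {lam : ℝ}
    (hlam : 0 ≤ lam) (ω : Ω) :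
    ∏ i ∈ T, {ω | θ i ≤ I i ω}.indicator (fun _ => (1 : ℝ)) ω ≤
      Real.exp (-(lam * ∑ i ∈ T, θ i)) * Real.exp (lam * ∑ i ∈ T, I i ω) := by
  have hsum : -(lam * ∑ i ∈ T, θ i) + lam * ∑ i ∈ T, I i ω = ∑ i ∈ T, lam * (I i ω - θ i) := by
    rw [Finset.mul_sum, Finset.mul_sum, ← Finset.sum_neg_distrib, ← Finset.sum_add_distrib]
    exact Finset.sum_congr rfl fun i _ => by ring
  rw [← Real.exp_add, hsum, Real.exp_sum]
  exact Finset.prod_le_prod (fun i _ => Set.indicator_nonneg (fun _ _ => zero_le_one) _)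
    fun i _ => indicator_le_exp_mul_sub (I i) (θ i) hlam ω

omit [IsProbabilityMeasure μ] in
/-- **Chebyshev, integrated.**  For measurable influence functionals `Iᵢ`, thresholds `θᵢ`, `λ ≥ 0`, and an
INTEGRABLE joint exponential tilt with `∫ exp(λ Σ_{i∈T} Iᵢ) dμ ≤ B`:
`∫ ∏_{i∈T} 1[θᵢ ≤ Iᵢ] dμ ≤ exp(−λ Σ_{i∈T} θᵢ) · B`. [folklore] -/
theorem integral_prod_indicator_le_of_expMoment {ι : Type*} (T : Finset ι) (I : ι → Ω → ℝ)
    (θ : ι → ℝ) {lam B : ℝ} (hlam : 0 ≤ lam)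
    (hint : Integrable (fun ω => Real.exp (lam * ∑ i ∈ T, I i ω)) μ)
    (hmom : ∫ ω, Real.exp (lam * ∑ i ∈ T, I i ω) ∂μ ≤ B) :
    ∫ ω, ∏ i ∈ T, {ω | θ i ≤ I i ω}.indicator (fun _ => (1 : ℝ)) ω ∂μ ≤
      Real.exp (-(lam * ∑ i ∈ T, θ i)) * B := by
  calc ∫ ω, ∏ i ∈ T, {ω | θ i ≤ I i ω}.indicator (fun _ => (1 : ℝ)) ω ∂μ
      ≤ ∫ ω, Real.exp (-(lam * ∑ i ∈ T, θ i)) * Real.exp (lam * ∑ i ∈ T, I i ω) ∂μ :=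
        integral_mono_of_nonneg
          (ae_of_all _ fun ω => Finset.prod_nonneg fun i _ => Set.indicator_nonneg (fun _ _ => zero_le_one) _)
          (hint.const_mul _) (ae_of_all _ fun ω => prod_indicator_le_exp T I θ hlam ω)
    _ = Real.exp (-(lam * ∑ i ∈ T, θ i)) * ∫ ω, Real.exp (lam * ∑ i ∈ T, I i ω) ∂μ := integral_const_mul _ _
    _ ≤ Real.exp (-(lam * ∑ i ∈ T, θ i)) * B := mul_le_mul_of_nonneg_left hmom (Real.exp_nonneg _)

omit [IsProbabilityMeasure μ] in
/-- **MULTIPLICATIVE RARITY FROM A JOINT EXPONENTIAL MOMENT BOUND (Chebyshev).**  If the influence functionals `Iᵢ`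
are measurable, `λ ≥ 0`, the joint tilt is integrable and `∫ exp(λ Σ_{i∈T} Iᵢ) dμ ≤ exp(B · #T)`, then the bad events
`{θ ≤ Iᵢ}` have multiplicative rarity `μ(⋂_{i∈T} {θ ≤ Iᵢ}) ≤ exp(B − λθ)^{#T}` — hypothesis (b) of the defect collar
(`DefectCollar.abs_integral_prod_sub_mean_le_of_defects`) with `δ = exp(B − λθ)`, on ANY probability space: no
reflection positivity, no tiling of a torus. [folklore] -/
theorem measureReal_biInter_le_pow_of_expMoment {ι : Type*} (T : Finset ι) (I : ι → Ω → ℝ)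
    (hI : ∀ i, Measurable (I i)) (θ : ℝ) {lam B : ℝ} (hlam : 0 ≤ lam)
    (hint : Integrable (fun ω => Real.exp (lam * ∑ i ∈ T, I i ω)) μ)
    (hmom : ∫ ω, Real.exp (lam * ∑ i ∈ T, I i ω) ∂μ ≤ Real.exp (B * T.card)) :
    μ.real (⋂ i ∈ T, {ω | θ ≤ I i ω}) ≤ (Real.exp (B - lam * θ)) ^ T.card := by
  have hmeas : ∀ i, MeasurableSet {ω | θ ≤ I i ω} := fun i => measurableSet_le measurable_const (hI i)
  rw [← integral_prod_indicator_eq_measureReal μ T (fun i => {ω | θ ≤ I i ω}) hmeas]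
  refine (integral_prod_indicator_le_of_expMoment μ T I (fun _ => θ) hlam hint hmom).trans (le_of_eq ?_)
  rw [Finset.sum_const, nsmul_eq_mul, ← Real.exp_add, ← Real.exp_nat_mul]
  congr 1
  ring

end Chebyshev

/-! ## §2 Polymer-gas domination: exponential moments of linear influence functionals from a Peierls product law -/

section PolymerGas

variable {κ : Type*}

omit [MeasurableSpace Ω] in
/-- The exponential of a tilted `{0,1}`-indicator: `exp(t · 1_E) = 1 + (e^t − 1) · 1_E`. [folklore] -/
theorem exp_mul_indicator_eq (E : Set Ω) (t : ℝ) (ω : Ω) :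
    Real.exp (t * E.indicator (fun _ => (1 : ℝ)) ω) =
      1 + (Real.exp t - 1) * E.indicator (fun _ => (1 : ℝ)) ω := by
  by_cases h : ω ∈ E
  · simp [Set.indicator_of_mem h]
  · simp [Set.indicator_of_notMem h]

omit [MeasurableSpace Ω] in
/-- **Expansion over sub-families.**  For a finite family `S` of events and tilts `t_γ`,
`exp(Σ_{γ∈S} t_γ 1_{E_γ}) = Σ_{A⊆S} (∏_{γ∈A} (e^{t_γ} − 1)) · ∏_{γ∈A} 1_{E_γ}` (multiply out
`∏_γ (1 + (e^{t_γ} − 1) 1_{E_γ})`). [folklore] -/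
theorem exp_sum_mul_indicator_eq_sum_powerset (S : Finset κ) (E : κ → Set Ω) (t : κ → ℝ) (ω : Ω) :
    Real.exp (∑ γ ∈ S, t γ * (E γ).indicator (fun _ => (1 : ℝ)) ω) =
      ∑ A ∈ S.powerset, (∏ γ ∈ A, (Real.exp (t γ) - 1)) *
        ∏ γ ∈ A, (E γ).indicator (fun _ => (1 : ℝ)) ω := by
  classical
  rw [Real.exp_sum]
  have h1 : ∏ γ ∈ S, Real.exp (t γ * (E γ).indicator (fun _ => (1 : ℝ)) ω) =
      ∏ γ ∈ S, ((Real.exp (t γ) - 1) * (E γ).indicator (fun _ => (1 : ℝ)) ω + 1) :=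
    Finset.prod_congr rfl fun γ _ => by rw [exp_mul_indicator_eq, add_comm]
  rw [h1, Finset.prod_add]
  refine Finset.sum_congr rfl fun A _ => ?_
  rw [Finset.prod_const_one, mul_one, Finset.prod_mul_distrib]

/-- **POLYMER-GAS DOMINATION OF EXPONENTIAL MOMENTS.**  Let `(E_γ)_{γ∈S}` be finitely many measurable events (read:
«the large-field polymer `γ` occurs in the configuration») obeying the Peierls PRODUCT LAW
`μ(⋂_{γ∈A} E_γ) ≤ ∏_{γ∈A} w_γ` for every sub-family `A ⊆ S` (in a genuine polymer representation incompatible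
polymers never occur together, so the law is only asked, in effect, of compatible families), and let `t_γ ≥ 0`.  Then
`∫ exp(Σ_{γ∈S} t_γ 1_{E_γ}) dμ ≤ ∏_{γ∈S} (1 + (e^{t_γ} − 1) w_γ)`: the interacting gas is dominated, in exponential
moments, by the ideal gas of intensities `w_γ`.  Proof: §2 expansion over sub-families, termwise integration with the
product law (all coefficients are `≥ 0`), `Finset.prod_add` backwards. [folklore; zeroth order of the polymer
expansion, cf. Kotecký–Preiss (1986)] -/
theorem integral_exp_sum_indicator_le_prod (S : Finset κ) (E : κ → Set Ω) (hE : ∀ γ, MeasurableSet (E γ))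
    (t w : κ → ℝ) (ht : ∀ γ ∈ S, 0 ≤ t γ)
    (hPL : ∀ A, A ⊆ S → μ.real (⋂ γ ∈ A, E γ) ≤ ∏ γ ∈ A, w γ) :
    ∫ ω, Real.exp (∑ γ ∈ S, t γ * (E γ).indicator (fun _ => (1 : ℝ)) ω) ∂μ ≤
      ∏ γ ∈ S, (1 + (Real.exp (t γ) - 1) * w γ) := by
  classical
  have hχm : ∀ γ, Measurable fun ω => (E γ).indicator (fun _ => (1 : ℝ)) ω := fun γ =>
    measurable_const.indicator (hE γ)
  have hχb : ∀ γ ω, |(E γ).indicator (fun _ => (1 : ℝ)) ω| ≤ 1 := fun γ ω => by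
    rw [abs_of_nonneg (Set.indicator_nonneg (fun _ _ => zero_le_one) _)]
    exact Set.indicator_apply_le' (fun _ => le_rfl) (fun _ => zero_le_one)
  -- the terms of the expansion are integrable (bounded measurable on a probability space)
  have hterm_m : ∀ A : Finset κ, Measurable fun ω =>
      (∏ γ ∈ A, (Real.exp (t γ) - 1)) * ∏ γ ∈ A, (E γ).indicator (fun _ => (1 : ℝ)) ω := fun A =>
    (Finset.measurable_prod A fun γ _ => hχm γ).const_mul _
  have hterm_i : ∀ A : Finset κ, Integrable (fun ω =>
      (∏ γ ∈ A, (Real.exp (t γ) - 1)) * ∏ γ ∈ A, (E γ).indicator (fun _ => (1 : ℝ)) ω) μ := fun A => by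
    refine integrable_of_abs_le (hterm_m A) (C := |∏ γ ∈ A, (Real.exp (t γ) - 1)| * 1) fun ω => ?_
    rw [abs_mul]
    refine mul_le_mul_of_nonneg_left ?_ (abs_nonneg _)
    have := Literature.MathematicalPhysics.QuantumLattice.abs_prod_le_pow A
      (f := fun γ ω => (E γ).indicator (fun _ => (1 : ℝ)) ω) (B := 1) (fun γ _ ω => hχb γ ω) ω
    simpa using this
  -- coefficients of the expansion are nonnegative
  have hcoef : ∀ A, A ⊆ S → 0 ≤ ∏ γ ∈ A, (Real.exp (t γ) - 1) := fun A hA =>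
    Finset.prod_nonneg fun γ hγ => sub_nonneg.2 (Real.one_le_exp (ht γ (hA hγ)))
  simp_rw [exp_sum_mul_indicator_eq_sum_powerset S E t]
  rw [integral_finsetSum _ fun A _ => hterm_i A]
  calc ∑ A ∈ S.powerset, ∫ ω, (∏ γ ∈ A, (Real.exp (t γ) - 1)) *
          ∏ γ ∈ A, (E γ).indicator (fun _ => (1 : ℝ)) ω ∂μ
      = ∑ A ∈ S.powerset, (∏ γ ∈ A, (Real.exp (t γ) - 1)) * μ.real (⋂ γ ∈ A, E γ) :=
        Finset.sum_congr rfl fun A _ => by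
          rw [integral_const_mul, integral_prod_indicator_eq_measureReal μ A E hE]
    _ ≤ ∑ A ∈ S.powerset, (∏ γ ∈ A, (Real.exp (t γ) - 1)) * ∏ γ ∈ A, w γ :=
        Finset.sum_le_sum fun A hA =>
          mul_le_mul_of_nonneg_left (hPL A (Finset.mem_powerset.1 hA)) (hcoef A (Finset.mem_powerset.1 hA))
    _ = ∑ A ∈ S.powerset, (∏ γ ∈ A, (Real.exp (t γ) - 1) * w γ) * ∏ γ ∈ S \ A, (1 : ℝ) :=
        Finset.sum_congr rfl fun A _ => by rw [Finset.prod_const_one, mul_one, Finset.prod_mul_distrib]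
    _ = ∏ γ ∈ S, ((Real.exp (t γ) - 1) * w γ + 1) := (Finset.prod_add _ _ S).symm
    _ = ∏ γ ∈ S, (1 + (Real.exp (t γ) - 1) * w γ) := Finset.prod_congr rfl fun γ _ => add_comm _ _

/-- **Ideal-gas form.**  Under the product law, with `t_γ ≥ 0` and `w_γ ≥ 0`:
`∫ exp(Σ_{γ∈S} t_γ 1_{E_γ}) dμ ≤ exp(Σ_{γ∈S} (e^{t_γ} − 1) w_γ)` (`1 + x ≤ eˣ` factorwise). [folklore] -/
theorem integral_exp_sum_indicator_le_exp (S : Finset κ) (E : κ → Set Ω) (hE : ∀ γ, MeasurableSet (E γ))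
    (t w : κ → ℝ) (ht : ∀ γ ∈ S, 0 ≤ t γ) (hw : ∀ γ ∈ S, 0 ≤ w γ)
    (hPL : ∀ A, A ⊆ S → μ.real (⋂ γ ∈ A, E γ) ≤ ∏ γ ∈ A, w γ) :
    ∫ ω, Real.exp (∑ γ ∈ S, t γ * (E γ).indicator (fun _ => (1 : ℝ)) ω) ∂μ ≤
      Real.exp (∑ γ ∈ S, (Real.exp (t γ) - 1) * w γ) := by
  refine (integral_exp_sum_indicator_le_prod μ S E hE t w ht hPL).trans ?_
  rw [Real.exp_sum]
  refine Finset.prod_le_prod (fun γ hγ => ?_) fun γ hγ => ?_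
  · have : 0 ≤ (Real.exp (t γ) - 1) * w γ :=
      mul_nonneg (sub_nonneg.2 (Real.one_le_exp (ht γ hγ))) (hw γ hγ)
    linarith
  · have := Real.add_one_le_exp ((Real.exp (t γ) - 1) * w γ)
    linarith

/-- **Joint exponential moments of LINEAR INFLUENCE FUNCTIONALS of a polymer gas.**  Events `E_γ` with the product
law and weights `w_γ ≥ 0`; influence coefficients `a_{iγ} ≥ 0` of the polymer `γ` on the cube `i` with
`Σ_{i∈T} a_{iγ} ≤ Λ` for every polymer (bounded total influence of one polymer on the family of separated cubes) and
`Σ_{γ∈S} a_{iγ} w_γ ≤ W` for every cube (mean influence — the «density» number, `≈ e^{−cβ}` for Bałaban-type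
large-field polymers); `λ ≥ 0`.  Then the influence functionals `Iᵢ = Σ_γ a_{iγ} 1_{E_γ}` satisfy
`∫ exp(λ Σ_{i∈T} Iᵢ) dμ ≤ exp(λ e^{λΛ} W · #T)` — the multiplicative budget §1 consumes.  Proof: exchange the sums,
ideal-gas form with tilts `t_γ = λ Σ_{i∈T} a_{iγ} ≤ λΛ`, and `e^{t} − 1 ≤ t e^{t} ≤ t e^{λΛ}`. [folklore] -/
theorem integral_exp_mul_sum_influence_le {ι : Type*} (T : Finset ι) (S : Finset κ) (E : κ → Set Ω)
    (hE : ∀ γ, MeasurableSet (E γ)) (w : κ → ℝ) (hw : ∀ γ ∈ S, 0 ≤ w γ)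
    (a : ι → κ → ℝ) (ha : ∀ i ∈ T, ∀ γ ∈ S, 0 ≤ a i γ) {lam Λ W : ℝ} (hlam : 0 ≤ lam)
    (hΛ : ∀ γ ∈ S, ∑ i ∈ T, a i γ ≤ Λ) (hW : ∀ i ∈ T, ∑ γ ∈ S, a i γ * w γ ≤ W)
    (hPL : ∀ A, A ⊆ S → μ.real (⋂ γ ∈ A, E γ) ≤ ∏ γ ∈ A, w γ) :
    ∫ ω, Real.exp (lam * ∑ i ∈ T, ∑ γ ∈ S, a i γ * (E γ).indicator (fun _ => (1 : ℝ)) ω) ∂μ ≤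
      Real.exp (lam * Real.exp (lam * Λ) * W * T.card) := by
  -- exchange the sums: the joint tilt is a polymer tilt with `t_γ = λ Σ_{i∈T} a_{iγ}`
  have hswap : ∀ ω, lam * ∑ i ∈ T, ∑ γ ∈ S, a i γ * (E γ).indicator (fun _ => (1 : ℝ)) ω =
      ∑ γ ∈ S, (lam * ∑ i ∈ T, a i γ) * (E γ).indicator (fun _ => (1 : ℝ)) ω := by
    intro ω
    rw [Finset.sum_comm, Finset.mul_sum]
    refine Finset.sum_congr rfl fun γ _ => ?_
    rw [mul_assoc, Finset.sum_mul]
  simp_rw [hswap]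
  have ht : ∀ γ ∈ S, 0 ≤ lam * ∑ i ∈ T, a i γ := fun γ hγ =>
    mul_nonneg hlam (Finset.sum_nonneg fun i hi => ha i hi γ hγ)
  refine (integral_exp_sum_indicator_le_exp μ S E hE _ w ht hw hPL).trans (Real.exp_le_exp.2 ?_)
  -- `e^{t} − 1 ≤ t e^{t}` (as the tree's `AreaLaw.exp_sub_one_le_mul_exp`, inlined to keep the import cone small)
  have hexp : ∀ x : ℝ, Real.exp x - 1 ≤ x * Real.exp x := fun x => by
    have h2 : Real.exp x * (1 - x) ≤ Real.exp x * Real.exp (-x) :=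
      mul_le_mul_of_nonneg_left (Real.one_sub_le_exp_neg x) (Real.exp_pos x).le
    rw [← Real.exp_add, add_neg_cancel, Real.exp_zero] at h2
    nlinarith
  -- `e^{t_γ} − 1 ≤ t_γ e^{λΛ}`, then resum
  have hΛ' : ∀ γ ∈ S, lam * ∑ i ∈ T, a i γ ≤ lam * Λ := fun γ hγ => mul_le_mul_of_nonneg_left (hΛ γ hγ) hlam
  calc ∑ γ ∈ S, (Real.exp (lam * ∑ i ∈ T, a i γ) - 1) * w γ
      ≤ ∑ γ ∈ S, ((lam * ∑ i ∈ T, a i γ) * Real.exp (lam * Λ)) * w γ := by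
        refine Finset.sum_le_sum fun γ hγ => mul_le_mul_of_nonneg_right ?_ (hw γ hγ)
        exact (hexp _).trans
          (mul_le_mul_of_nonneg_left (Real.exp_le_exp.2 (hΛ' γ hγ)) (ht γ hγ))
    _ = ∑ γ ∈ S, lam * Real.exp (lam * Λ) * ∑ i ∈ T, a i γ * w γ := by
        refine Finset.sum_congr rfl fun γ _ => ?_
        rw [← Finset.sum_mul]
        ring
    _ = lam * Real.exp (lam * Λ) * ∑ i ∈ T, ∑ γ ∈ S, a i γ * w γ := by
        rw [← Finset.mul_sum, Finset.sum_comm]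
    _ ≤ lam * Real.exp (lam * Λ) * ∑ _i ∈ T, W := by
        refine mul_le_mul_of_nonneg_left (Finset.sum_le_sum fun i hi => hW i hi) ?_
        exact mul_nonneg hlam (Real.exp_nonneg _)
    _ = lam * Real.exp (lam * Λ) * W * T.card := by
        rw [Finset.sum_const, nsmul_eq_mul]; ring

/-- **MULTIPLICATIVE RARITY FROM THE POLYMER LAW (the supplier of hypothesis (b) of the defect collar with no
reflection positivity and no divisibility).**  In the setting of `integral_exp_mul_sum_influence_le`, for every
threshold `θ`: `μ(⋂_{i∈T} {θ ≤ Σ_γ a_{iγ} 1_{E_γ}}) ≤ exp(λ e^{λΛ} W − λ θ)^{#T}`.  Read: a cube is BAD when the polymers of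
the large-field gas exert total influence `≥ θ` on it; bad cubes at separated sites are multiplicatively rare at the
rate `exp(λ e^{λΛ} W − λθ)`, which is `≤ C₂/R⁴` as soon as `λθ ≥ λ e^{λΛ} W + 4 log R − log C₂`. [folklore] -/
theorem measureReal_biInter_le_pow_of_polymerLaw {ι : Type*} (T : Finset ι) (S : Finset κ) (E : κ → Set Ω)
    (hE : ∀ γ, MeasurableSet (E γ)) (w : κ → ℝ) (hw : ∀ γ ∈ S, 0 ≤ w γ)
    (a : ι → κ → ℝ) (ha : ∀ i ∈ T, ∀ γ ∈ S, 0 ≤ a i γ) {lam Λ W : ℝ} (θ : ℝ) (hlam : 0 ≤ lam)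
    (hΛ : ∀ γ ∈ S, ∑ i ∈ T, a i γ ≤ Λ) (hW : ∀ i ∈ T, ∑ γ ∈ S, a i γ * w γ ≤ W)
    (hPL : ∀ A, A ⊆ S → μ.real (⋂ γ ∈ A, E γ) ≤ ∏ γ ∈ A, w γ) :
    μ.real (⋂ i ∈ T, {ω | θ ≤ ∑ γ ∈ S, a i γ * (E γ).indicator (fun _ => (1 : ℝ)) ω}) ≤
      (Real.exp (lam * Real.exp (lam * Λ) * W - lam * θ)) ^ T.card := by
  classical
  have hχm : ∀ γ, Measurable fun ω => (E γ).indicator (fun _ => (1 : ℝ)) ω := fun γ =>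
    measurable_const.indicator (hE γ)
  have hIm : ∀ i, Measurable fun ω => ∑ γ ∈ S, a i γ * (E γ).indicator (fun _ => (1 : ℝ)) ω := fun i =>
    Finset.measurable_sum S fun γ _ => (hχm γ).const_mul _
  -- the statement only involves the indices in `T`; restrict the influence coefficients to `T` (zero elsewhere)
  -- is not needed: we bound the joint tilt over `T` directly.
  have hχ01 : ∀ γ ω, 0 ≤ (E γ).indicator (fun _ => (1 : ℝ)) ω ∧ (E γ).indicator (fun _ => (1 : ℝ)) ω ≤ 1 :=
    fun γ ω => ⟨Set.indicator_nonneg (fun _ _ => zero_le_one) _,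
      Set.indicator_apply_le' (fun _ => le_rfl) (fun _ => zero_le_one)⟩
  -- integrability of the joint tilt: bounded by the constant `exp(λ Σ_{i∈T} Σ_γ |a_{iγ}|)`
  have hint : Integrable (fun ω => Real.exp (lam * ∑ i ∈ T, ∑ γ ∈ S,
      a i γ * (E γ).indicator (fun _ => (1 : ℝ)) ω)) μ := by
    refine integrable_of_abs_le ((Finset.measurable_sum T fun i _ => hIm i).const_mul lam).exp
      (C := Real.exp (lam * ∑ i ∈ T, ∑ γ ∈ S, |a i γ|)) fun ω => ?_
    rw [Real.abs_exp]
    refine Real.exp_le_exp.2 (mul_le_mul_of_nonneg_left ?_ hlam)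
    refine Finset.sum_le_sum fun i _ => Finset.sum_le_sum fun γ _ => ?_
    calc a i γ * (E γ).indicator (fun _ => (1 : ℝ)) ω ≤ |a i γ * (E γ).indicator (fun _ => (1 : ℝ)) ω| :=
          le_abs_self _
      _ = |a i γ| * |(E γ).indicator (fun _ => (1 : ℝ)) ω| := abs_mul _ _
      _ ≤ |a i γ| * 1 := by
          refine mul_le_mul_of_nonneg_left ?_ (abs_nonneg _)
          rw [abs_of_nonneg (hχ01 γ ω).1]
          exact (hχ01 γ ω).2
      _ = |a i γ| := mul_one _
  exact measureReal_biInter_le_pow_of_expMoment μ T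
    (fun i ω => ∑ γ ∈ S, a i γ * (E γ).indicator (fun _ => (1 : ℝ)) ω) hIm θ hlam hint
    (integral_exp_mul_sum_influence_le μ T S E hE w hw a ha hlam hΛ hW hPL)

omit [IsProbabilityMeasure μ] in
/-- **Dominated bad events.**  If each bad event `Bad i` (`i ∈ T`) is contained in the super-level set
`{θ ≤ Iᵢ}` of an influence functional and the super-level sets are multiplicatively rare, so are the bad events:
`μ(⋂_{i∈T} Bad i) ≤ μ(⋂_{i∈T} {θ ≤ Iᵢ})`. [folklore] -/
theorem measureReal_biInter_le_of_subset_superlevel {ι : Type*} [IsFiniteMeasure μ] (T : Finset ι)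
    (Bad : ι → Set Ω) (I : ι → Ω → ℝ) (θ : ℝ) (hBad : ∀ i ∈ T, Bad i ⊆ {ω | θ ≤ I i ω}) :
    μ.real (⋂ i ∈ T, Bad i) ≤ μ.real (⋂ i ∈ T, {ω | θ ≤ I i ω}) :=
  measureReal_mono (Set.iInter₂_mono fun i hi => hBad i hi)

end PolymerGas

end Summit.QuantumFields.YangMills.Cruxes.UVSeamRec.PolymerRarity

end
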